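import Summits.QuantumFields.BalabanUV.T4Continuum.Spine.NE3.SupplierB8SfClassSizes
import Summits.QuantumFields.BalabanUV.T4Continuum.Spine.NE3.PairLandauB8EndSfClassR25
import HarnessLib

/-!
# T⁴ programme, node NE3 — census R26′, step 2d-δ (2∕2): THE END ON B8's SURFACE OVER `sfClass` WITHOUT THE (Π-REG) BINDER
# (`PairLandauB8EndSfClassB8.ne3EnergyRateWCov_sfClass_B8`, p353587 ✓, with its per-pair input `hF6` — the Π-REG majorant — DELETED)

Cell `pub-balaban-gaps` (track G2, seat `ne3`; writer prover-pub-balaban-gaps-ne3-g4-0, 2026-08-23), census `run/shared/lean/pub/pub-balaban-gaps/ne/NE3.md` §4 R26′ ∕ §10 F8.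
WHAT.  NE3's local half on B8's surface over Bałaban's class as ONE implication: `NE3EnergyRateWCov d (sfClass d L N ε) L N b g C s₁ s₂ dom` ⇐ `PairLandauGaugeB8Avg … s₁ s₂ 1 dom`
([Balaban1985RegularSpaces] Thm 2 + (1.37) ∘ [Balaban1985Variational] Thm 1 TYPE) ∧ per-pair `LandauCorrectionSupB8` ([Balaban1985BackgroundPropagators] (3.42)∕(3.48) TYPE; F5) ∧
per-pair (P♮) on `slicB8` ([Balaban1985BackgroundPropagators] Thm 3.3 TYPE) ∧ UNIFORM numeric lines — and NOTHING ELSE: the (Π-REG) regularity majorant of p353587 is GONE, its two uses (the ν-letter's `dirSq φ` and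
the ℓ¹-curl letter's `dirL1 φ`, `φ = QbarIter L (j+1) W Z`) being theorems of the remainder towers (`RemainderTowerB8`, `RemainderL1FinalB8`; finding F8) through
`SupplierB8SfClassSizes.decomposedRepT_sfClass_of_landauRepB8Avg_towers`.  The price: the [B7]-Prop-4 regime lines doubled, four k-free uniform lines (`16K·s₁ ≤ √(L²∕L^d)`,
`K₁·(8∕3)(ε∕L²) ≤ (L∕L^d)∕2`, `(32K)²L^d ≤ P²L⁴`, `64K₁′L^d ≤ QL²`) and the letters `P`, `Q` replacing `C₂Ĉ`, `C₂Ĉ²` in `ν̂`, `κ̂₁`, `κ̂₂`, `hρ`, `hbudget`.  At `d = 4` every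
displayed line is k-free (N enters `κ̂₁` through the lift's ℓ¹-curl letter, as in p353587 — finite volume).

CONTENT (0 sorry, no `def`): **`ne3EnergyRateWCov_sfClass_towers`** [folklore].

HONEST FRAMING.  An implication on OUR objects: `PairLandauGaugeB8Avg`, the F5 shape and (P♮) on `slicB8` are printed-TYPE hypotheses, OPEN for Bałaban's minimisers; the uniform
numeric lines are hypotheses (non-vacuity at d = 4, L = 2 NOT checked — census G4); NOTHING of Bałaban's is proved; **NE3 is NOT proved**; spine PROVED 0∕9; finite T⁴ rung (B)+1 —
NOT continuum YM on ℝ⁴, NOT infinite volume, NOT mass gap, NOT `BetaPertH`, NOT Clay.  PLACEMENT: `Summits/QuantumFields/BalabanUV/T4Continuum/Spine/NE3/`.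
-/

set_option autoImplicit false

open scoped BigOperators Matrix.Norms.L2Operator
open NormedSpace Finset

namespace Summit.QuantumFields.BalabanUV.T4Continuum.NE3.PairLandauB8EndSfClassTowers

open Set
open Literature.MathematicalPhysics.QuantumFieldTheory.Balaban1983to89
open B7Prop1Explicit B7Prop2Explicit B7Prop3Flat MatrixLog
open T4AveragingDeficitWall (IsSkewDir IsUnitaryCfg SmallField)
open T4AveragingDeficitWallBoundary (IsPeriodicCfg periodBox)
open AveragingDeficitPeriodicCounting (IsPeriodicDir)
open AveragingDeficitChartCalculus (cavg)
open AveragingDeficitMultiLevelPrep (LevelSmall)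
open AveragingDeficitTwoLevelPrep (twoLevelSmall)
open MinimalActionSandwich (IsMinimiser)
open MinimalActionRate (Regular sfClass)
open NE3EnergyWeightedCovShape (NE3EnergyRateWCov)
open NE3SlicePoincareShape (SlicePoincare)
open NE3EnergyRateWSupOfSlicePoincare (cLambda)
open BlockAverageVaryHolo (nbRad)
open NE3CovariantLineSumsError (Csup)
open ShellMeasureAverageProp4General (C1cov)
open NE3QbarIterCovLiftPrep (cruxC liftC liftC_nonneg)
open NE3RightInverseSolveLetters (thetaLoc)
open NE3.PairLandauB8Avg (LandauRepB8Avg PairLandauGaugeB8Avg slicB8)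
open NE3.LandauProjectionSupShape (LandauCorrectionSupB8)
open NE3.SupplierB8SfClassSizes (decomposedRepT_sfClass_of_landauRepB8Avg_towers)
open NE3.PairLandauB8EndSfClassR25 (ne3EnergyRateWCov_sfClass_of_pairLandauGaugeB8Avg_R25)

noncomputable section

variable {d : ℕ} {n : Type*} [Fintype n] [DecidableEq n]

/-- **THE END ON B8's SURFACE OVER `sfClass` WITHOUT Π-REG** (supplier, tangent projection bound AND the two coarse sizes of `φ` discharged; see the module docstring):
`NE3EnergyRateWCov d (sfClass d L N ε) L N b g ((1+θ₀)(4∕cΛ)(K₂₅·C′_{R♯5d})) s₁ s₂ dom` from `PairLandauGaugeB8Avg`, per-pair `LandauCorrectionSupB8` (uniform `K₀ K₁`), per-pair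
(P♮) on `slicB8` (uniform `CP`), and uniform numeric lines. [folklore] -/
theorem ne3EnergyRateWCov_sfClass_towers [Nonempty n] (hd : 3 ≤ d) {L N : ℕ} [NeZero L] [NeZero N] (hL : 2 ≤ L) (hN : 1 ≤ N)
    {ε b g : ℝ} (hb : 0 ≤ b) (hbε : b < ε) (hε1 : ε ≤ 1) (hg : 0 < g)
    (hbs : 512 * (d + 1) * (d + 4) * (L : ℝ) ^ 2 * b ≤ 1) (hbε' : b + 226 * (8 * (d + 1) * (d + 4)) ^ 2 * b ^ 2 ≤ ε)
    (h1 : 16 * (14464 * ((d : ℝ) + 1) ^ 2 * ((d : ℝ) + 4) ^ 2) * ε ≤ 3) (h2 : 2 * twoLevelSmall d L * ε ≤ (L : ℝ) ^ 2)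
    (hθε : cruxC d L * ε < 1) (hθlε : thetaLoc d L * ε < 1)
    (hPsε : 8 * d * (((d : ℝ) - 1) * ε) ^ 2
      + 2 * (Fintype.card n * ((4 * (d : ℝ) ^ 2 + 16 * d * (17 * (((d : ℝ) + 1) * ((d : ℝ) + 4)))) * ε) ^ 2) ≤ 1 / 2)
    -- the [B7]-Prop-4 regime
    {α₀ s₁ s₂ : ℝ} (hα : 0 < α₀) (hα3 : C0 d * (2 * α₀) ≤ 1 / 3) (hα4 : 4 * (2 * α₀) ≤ c2' d L) (hεα : ε < α₀) (hs₁ : 0 ≤ s₁)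
    (hsmall : Real.exp (4 * (800 * ((d : ℝ) + 1) ^ 2 * ((d : ℝ) + 4)) * α₀) * (1 + 8 * (131072 * ((d : ℝ) + 1) ^ 2) * s₁) ≤ 2)
    (hc₃ : 4 * s₁ ≤ c3 d L)
    -- the remainder towers' k-free lines and the two letters `P`, `Q` of the coarse sizes of `φ`
    (hK : 16 * (C1cov d * (L : ℝ) ^ 2 * Real.sqrt (d * (2 * (2 * L) + 1) ^ d)) * s₁ ≤ Real.sqrt ((L : ℝ) ^ 2 / (L : ℝ) ^ d))
    (hS1 : (16 * (d + 1) * (d + 4) * (L : ℝ) ^ 2 * Csup d L * (d * (2 * nbRad d L + 1) ^ d)) * (8 / 3 * (ε / (L : ℝ) ^ 2)) ≤ ((L : ℝ) / (L : ℝ) ^ d) / 2)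
    {P Q : ℝ} (hP0 : 0 ≤ P) (hQ0 : 0 ≤ Q)
    (hPl : (32 * (C1cov d * (L : ℝ) ^ 2 * Real.sqrt (d * (2 * (2 * L) + 1) ^ d))) ^ 2 * (L : ℝ) ^ d ≤ P ^ 2 * (L : ℝ) ^ 4)
    (hQl : 64 * (C1cov d * (L : ℝ) ^ 2 * (d * (2 * (2 * (L : ℝ)) + 1) ^ d)) * (L : ℝ) ^ d ≤ Q * (L : ℝ) ^ 2)
    -- the uniform constants and letters, and the uniform size lines
    {K₀ K₁ AN Ac ah Λ CP : ℝ} (hK₀ : 0 ≤ K₀) (hK₁ : 0 ≤ K₁) (hCP : 0 ≤ CP)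
    (hAN : (liftC d / (1 - cruxC d L * ε) + K₁) * ((8 * (131072 * ((d : ℝ) + 1) ^ 2) * Real.exp (4 * (800 * ((d : ℝ) + 1) ^ 2 * ((d : ℝ) + 4)) * α₀)) * s₁ ^ 2) ≤ AN)
    (hAc : (2 * (liftC d * (17 + 16 * (d : ℝ))) / (1 - cruxC d L * ε) + 2 * ε * K₀) * ((8 * (131072 * ((d : ℝ) + 1) ^ 2) * Real.exp (4 * (800 * ((d : ℝ) + 1) ^ 2 * ((d : ℝ) + 4)) * α₀)) * s₁ ^ 2) ≤ Ac)
    (hah : 3 * ε + 2 * Ac + 8192 * ((s₁ + AN) * AN) + 48 * s₁ ^ 2 + 1300 * ((s₁ + AN) + (1 + 2048 * (s₁ + AN)) * AN) ^ 2 ≤ ah)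
    (hlines₁ : 50 * s₁ ≤ 1) (hlineJ : s₁ + 43 * AN ≤ 1) (hlineN : 1350 * AN ≤ 1) (hlineα : 20 * (s₁ + AN) ≤ 1)
    (hlineαN : 50 * ((1 + 1024 * (s₁ + AN)) * AN) ≤ 1)
    (hρ : 2 * ((2 * (liftC d / (1 - thetaLoc d L * ε)) ^ 2 + 8 * Fintype.card n * ((d : ℝ) * liftC d ^ 2 * (2 * (d : ℝ) + 8) ^ 2 / (1 - thetaLoc d L * ε) ^ 2)) + (2 * (4 * d * (liftC d * (17 + 16 * (d : ℝ))) ^ 2 / (1 - thetaLoc d L * ε) ^ 2) + 128 * Fintype.card (T4AveragingDeficitWall.Plane d) * Fintype.card n * ((d : ℝ) * liftC d ^ 2 * (2 * (d : ℝ) + 8) ^ 2 / (1 - thetaLoc d L * ε) ^ 2))) * P ^ 2 * s₁ ^ 2 ≤ 1 / 2)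
    (hlineΛ : (1 + 24 * Real.sqrt d * (Real.exp (10 * ((s₁ + AN) + (1 + 2048 * (s₁ + AN)) * AN)) - 1)) ^ 2 + 48 * d * ah ≤ Λ)
    (hlineCP : 112 * (d : ℝ) * ah * CP ≤ 1 / (2 * (Fintype.card n : ℝ)))
    (hreg₁ : CP * (Real.sqrt Λ - 1) ^ 2 ≤ 1 / 4)
    (hbudget : 2 * Λ * (2 * (1 + 4 * Real.sqrt (16 * d + 1)) * ((1 + 2048 * Real.sqrt (16 * d + 1)) * (2 * Real.sqrt ((2 * (liftC d / (1 - thetaLoc d L * ε)) ^ 2 + 8 * Fintype.card n * ((d : ℝ) * liftC d ^ 2 * (2 * (d : ℝ) + 8) ^ 2 / (1 - thetaLoc d L * ε) ^ 2)) + (2 * (4 * d * (liftC d * (17 + 16 * (d : ℝ))) ^ 2 / (1 - thetaLoc d L * ε) ^ 2) + 128 * Fintype.card (T4AveragingDeficitWall.Plane d) * Fintype.card n * ((d : ℝ) * liftC d ^ 2 * (2 * (d : ℝ) + 8) ^ 2 / (1 - thetaLoc d L * ε) ^ 2))) * P * s₁))) + Λ * (2 * (1 + 4 * Real.sqrt (16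 * d + 1)) * ((1 + 2048 * Real.sqrt (16 * d + 1)) * (2 * Real.sqrt ((2 * (liftC d / (1 - thetaLoc d L * ε)) ^ 2 + 8 * Fintype.card n * ((d : ℝ) * liftC d ^ 2 * (2 * (d : ℝ) + 8) ^ 2 / (1 - thetaLoc d L * ε) ^ 2)) + (2 * (4 * d * (liftC d * (17 + 16 * (d : ℝ))) ^ 2 / (1 - thetaLoc d L * ε) ^ 2) + 128 * Fintype.card (T4AveragingDeficitWall.Plane d) * Fintype.card n * ((d : ℝ) * liftC d ^ 2 * (2 * (d : ℝ) + 8) ^ 2 / (1 - thetaLoc d L * ε) ^ 2))) * P * s₁))) ^ 2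
        + (2 * (4 * (2 * d * (liftC d * (17 + 16 * (d : ℝ))) / (1 - thetaLoc d L * ε) + 8 * Fintype.card (T4AveragingDeficitWall.Plane d) * Real.sqrt (Fintype.card n * ((d : ℝ) * liftC d ^ 2 * (2 * (d : ℝ) + 8) ^ 2 / (1 - thetaLoc d L * ε) ^ 2) * (N : ℝ) ^ d)) * Q * ah + 8192 * d * (4 * (liftC d / (1 - thetaLoc d L * ε) + 2 * Real.sqrt ((d : ℝ) * Fintype.card n * ((d : ℝ) * liftC d ^ 2 * (2 * (d : ℝ) + 8) ^ 2 / (1 - thetaLoc d L * ε) ^ 2) * (N : ℝ) ^ d)) * Q * ah)) + 912 * d * (1806 * (4 * (liftC d / (1 - thetaLoc d L * ε) + 2 * Real.sqrt ((d : ℝ) * Fintype.card n * ((d : ℝ) * liftC d ^ 2 * (2 * (d : ℝ) + 8) ^ 2 / (1 - thetaLoc d L * ε) ^ 2) * (N : ℝ) ^ d)) * Q * ah))) ≤ cLambda n CP Λ / 2)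
    -- [B8] Thm 2 + (1.37) at the pair, over the class
    {dom : _root_.Set (Site d → Fin d → (Matrix n n ℂ)ˣ)} (hB8 : PairLandauGaugeB8Avg d (sfClass d L N ε) L N b g s₁ s₂ 1 dom)
    -- per pair: the F5 shape (uniform constants `K₀ K₁`; for all proof arguments)
    (hF5 : ∀ j : ℕ, ∀ V ∈ dom, ∀ UB : Site d → Fin d → (Matrix n n ℂ)ˣ,
      IsMinimiser d (sfClass d L N ε) L N (j + 2) V UB → Regular d L N b g (j + 2) UB →
      ∀ (hWu : IsUnitaryCfg (cavg L UB)) (hx : 0 ≤ ε / ((L : ℝ) ^ (j + 1)) ^ 2) (hs : LevelSmall d L j (ε / ((L : ℝ) ^ (j + 1)) ^ 2))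
        (hWx : SmallField (cavg L UB) (ε / ((L : ℝ) ^ (j + 1)) ^ 2))
        (hθ : cruxC d L * (((L : ℝ) ^ (j + 1)) ^ 2 * (ε / ((L : ℝ) ^ (j + 1)) ^ 2)) < 1), LandauCorrectionSupB8 hL j hWu hx hs hWx N hθ K₀ K₁)
    -- per pair: (P♮) on B8's slice (uniform constant `CP`)
    (hP : ∀ j : ℕ, ∀ V ∈ dom, ∀ UB : Site d → Fin d → (Matrix n n ℂ)ˣ,
      IsMinimiser d (sfClass d L N ε) L N (j + 2) V UB → Regular d L N b g (j + 2) UB →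
      SlicePoincare L (j + 1) (cavg L UB) (slicB8 L N (j + 1) (cavg L UB)) CP (periodBox (N * L ^ (j + 1)))) :
    NE3EnergyRateWCov d (sfClass d L N ε) L N b g
      ((1 + (((1 + 2048 * Real.sqrt (16 * d + 1)) * (2 * Real.sqrt ((2 * (liftC d / (1 - thetaLoc d L * ε)) ^ 2 + 8 * Fintype.card n * ((d : ℝ) * liftC d ^ 2 * (2 * (d : ℝ) + 8) ^ 2 / (1 - thetaLoc d L * ε) ^ 2)) + (2 * (4 * d * (liftC d * (17 + 16 * (d : ℝ))) ^ 2 / (1 - thetaLoc d L * ε) ^ 2) + 128 * Fintype.card (T4AveragingDeficitWall.Plane d) * Fintype.card n * ((d : ℝ) * liftC d ^ 2 * (2 * (d : ℝ) + 8) ^ 2 / (1 - thetaLoc d L * ε) ^ 2))) * P * s₁)) + 23 * Real.sqrt 2 * Real.sqrt (16 * d + 1) * (1 + ((1 + 2048 * Real.sqrt (16 * d + 1)) * (2 * Real.sqrt ((2 * (liftC d / (1 - thetaLoc d L * ε)) ^ 2 + 8 * Fintype.card n * ((d : ℝ) * liftC d ^ 2 * (2 * (d : ℝ) + 8) ^ 2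 / (1 - thetaLoc d L * ε) ^ 2)) + (2 * (4 * d * (liftC d * (17 + 16 * (d : ℝ))) ^ 2 / (1 - thetaLoc d L * ε) ^ 2) + 128 * Fintype.card (T4AveragingDeficitWall.Plane d) * Fintype.card n * ((d : ℝ) * liftC d ^ 2 * (2 * (d : ℝ) + 8) ^ 2 / (1 - thetaLoc d L * ε) ^ 2))) * P * s₁))))) * (4 / cLambda n CP Λ)
        * ((1 + Real.sqrt (192 * ((d : ℝ) * L) * (d + Fintype.card (T4AveragingDeficitWall.Plane d))))
          * (Real.sqrt ((L : ℝ) ^ (d - 2))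
            + (Real.sqrt ((L : ℝ) ^ (d - 2)) * Real.sqrt (8 * Fintype.card (T4AveragingDeficitWall.Plane d))
                * (128 * (d * (L : ℝ) ^ 2))
              + 2 * (2048 * ((d : ℝ) + 4) ^ 2 * (L : ℝ) ^ 2 * Real.sqrt (d * (L : ℝ) ^ d))) * b
            + b ^ 2 * (2 * (L : ℝ) ^ (d - 1) + 2 * (8 * d * (L : ℝ) ^ d)) * Real.sqrt (d / (g * (L : ℝ) ^ (d + 2))))))
      s₁ s₂ dom := by
  have hql : 0 < 1 - thetaLoc d L * ε := by linarith only [hθlε]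
  have hlC := liftC_nonneg d
  have hν : 0 ≤ ((1 + 2048 * Real.sqrt (16 * d + 1)) * (2 * Real.sqrt ((2 * (liftC d / (1 - thetaLoc d L * ε)) ^ 2 + 8 * Fintype.card n * ((d : ℝ) * liftC d ^ 2 * (2 * (d : ℝ) + 8) ^ 2 / (1 - thetaLoc d L * ε) ^ 2)) + (2 * (4 * d * (liftC d * (17 + 16 * (d : ℝ))) ^ 2 / (1 - thetaLoc d L * ε) ^ 2) + 128 * Fintype.card (T4AveragingDeficitWall.Plane d) * Fintype.card n * ((d : ℝ) * liftC d ^ 2 * (2 * (d : ℝ) + 8) ^ 2 / (1 - thetaLoc d L * ε) ^ 2))) * P * s₁)) := by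
    have h1 : 0 ≤ 1 + 2048 * Real.sqrt (16 * (d : ℝ) + 1) := by positivity
    have h2 : 0 ≤ 2 * Real.sqrt ((2 * (liftC d / (1 - thetaLoc d L * ε)) ^ 2 + 8 * Fintype.card n * ((d : ℝ) * liftC d ^ 2 * (2 * (d : ℝ) + 8) ^ 2 / (1 - thetaLoc d L * ε) ^ 2)) + (2 * (4 * d * (liftC d * (17 + 16 * (d : ℝ))) ^ 2 / (1 - thetaLoc d L * ε) ^ 2) + 128 * Fintype.card (T4AveragingDeficitWall.Plane d) * Fintype.card n * ((d : ℝ) * liftC d ^ 2 * (2 * (d : ℝ) + 8) ^ 2 / (1 - thetaLoc d L * ε) ^ 2))) := by positivity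
    exact mul_nonneg h1 (mul_nonneg (mul_nonneg h2 hP0) hs₁)
  refine ne3EnergyRateWCov_sfClass_of_pairLandauGaugeB8Avg_R25 hd hL hN hb hbε hε1 hg hbs hbε' h1 h2 hCP hreg₁ hν hbudget hB8 ?_
  intro j V hV UA UB hA hB hreg u Z hZ
  have hε : 0 ≤ ε := by linarith only [hb, hbε]
  obtain ⟨X, Nn, α, αN, a, hdec, hΓ0, hα40, hαN100, hJ1, hJ2⟩ :=
    decomposedRepT_sfClass_of_landauRepB8Avg_towers hd hL hN hb hε hε1 hbs hbε' h1 h2 hθε hθlε hPsε hα hα3 hα4 hεα hs₁ hsmall hc₃ hK hS1 hP0 hQ0 hPl hQl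
      hK₀ hK₁ hCP hAN hAc hah hlines₁ hlineJ hlineN hlineα hlineαN hρ hlineΛ hlineCP j hA hB hreg hZ (hF5 j V hV UB hB hreg)
  exact ⟨X, Nn, α, αN, a, hdec, hΓ0, hα40, hαN100, hJ1, hJ2, hP j V hV UB hB hreg⟩

end

end Summit.QuantumFields.BalabanUV.T4Continuum.NE3.PairLandauB8EndSfClassTowers
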